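import Mathlib
import Summits.NavierStokesRegularity.NavierStokesRegularity.Theorems.LerayQuarterDissipationFiniteDissipationLiouvilleCrossFlowRigidity
import Summits.NavierStokesRegularity.NavierStokesRegularity.Theorems.LerayQuarterDissipationFiniteDissipationLiouvilleSmallDissipationGap
import HarnessLib

/-!
# Crux `FiniteDissipationLiouville` (stmt-NavierStokesRegularity-22144): the CROSS-FLOW THRESHOLD
# ONE on the DSS wall — Bradshaw–Tsai OP 5.1 holds, every factor, for Type-I DSS profiles whose
# velocity across the vorticity never exceeds the self-similar speed (`√(−t)‖ω × u‖ ≤ ‖ω‖`)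

Theorems file of route `LerayQuarterDissipation` (lead prover g17; `--supports` the crux; sequel of
`…CrossFlowRigidity`). Navier–Stokes regularity is NOT proved by anything here; no summit is.

The tree's law-free cross-flow rung (`…SimilarityEnstrophy.typeI_ancient_eq_zero_of_crossFlow_lt_one`,
pub-ns-dss) kills every enveloped KNSS-gauge Type-I field with `√(−t)‖ω × u‖ ≤ θ‖ω‖`, `θ < 1`.
AT THE THRESHOLD `θ = 1` the similarity-enstrophy budget has no damping left but keeps a SLACK:

* `hasDerivAt_enstrophy_eq_neg_two_integral_slack` — for an enveloped Type-I field,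
  `Z'(s) = −2∫σ(s)`, `σ = ‖curl Ω‖² + ¼‖Ω‖² − ⟪U, Ω × curl Ω⟫` (the global budget
  `…SimilarityEnstrophyIdentity.similarityEnstrophy_hasDerivAt`, the Lamb form of the stretching and
  the whole-space `div`–`curl` identity of `…LambCore`);
* `antitone_enstrophy_of_crossFlow_le_one` — under cross-flow `≤ 1` the slack density is `≥ 0`
  (`…CrossFlowRigidity.crossFlowSlack_nonneg`), so **the global similarity enstrophy is
  NON-INCREASING in similarity time**;
* `eq_zero_of_crossFlow_le_one_of_enstrophy_periodic` — if moreover `Z` is periodic it is constant,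
  the slack vanishes identically, every slice is in the equality case, hence irrotational
  (`…CrossFlowRigidity.lerayVorticity_slice_eq_zero_of_crossFlowSlack_eq_zero`), hence `V ≡ 0`;
* `lerayOrbit_sub_period_of_pastDss` — past-DSS with factor `c` makes the Leray orbit, hence `Z`,
  `2 log c`-periodic;
* **`eq_zero_of_pastDss_of_crossFlow_le_one`** — **a KNSS-gauge Type-I field with a Type-I envelope,
  discretely self-similar on the past with ANY factor `c > 1`, with `√(−t)‖ω(t,x) × V(t,x)‖ ≤ ‖ω(t,x)‖`
  for all `t < 0`, `x`, vanishes identically**: the cross-flow threshold `θ = 1` is NOT ATTAINED on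
  the DSS wall (the tree had `θ < 1`); `eq_zero_of_pastDss_of_crossFlow_le_one'` for
  `IsDiscretelySelfSimilar`.

HONEST FRAMING. A restriction of the catalogued open problem (`TypeIDSSLiouville`, NECESSARY for the
crux) to an explicit sub-class, extending a law-free threshold row to its endpoint on DSS fields;
the Type-I and envelope constants are taken equal (`IsTypeIAncientMild C V`, `HasTypeIDecay C V`; use
`isTypeIAncientMild_of_le` / `hasTypeIDecay_of_le` to equalise); for non-self-similar (wandering)
members the monotone enstrophy does not by itself exclude the threshold (a compactness step would be
needed; not done). Nothing here bears on Navier–Stokes regularity or blow-up.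

References: Bradshaw–Tsai, Comm. PDE 42 (2017) OP 5.1; Chae–Wolf, arXiv:1610.09464 §4 (DSS ⇔
periodic Leray orbit); Koch–Nadirashvili–Seregin–Šverák, Acta Math. 203 (2009) §4; Doering–Gibbon
(1995) §1.4.
-/

noncomputable section

set_option linter.dupNamespace false

namespace Summit.NavierStokesRegularity.NavierStokesRegularity.Theorems.FiniteDissipationLiouville.CrossFlow

open MeasureTheory Set Filter Topology Metric InnerProductSpace Function Real
open scoped RealInnerProductSpace ContDiff
open Literature.Analysis Literature.Analysis.FluidPDE
open Summit.NavierStokesRegularity.NavierStokesRegularity.Theorems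
open Summit.NavierStokesRegularity.NavierStokesRegularity.Theorems.GaussianGap
open Summit.NavierStokesRegularity.NavierStokesRegularity.Theorems.SimilarityEnstrophy
open Summit.NavierStokesRegularity.NavierStokesRegularity.Theorems.SmallDissipationGap

variable {C : ℝ} {V : ℝ → EuclideanSpace ℝ (Fin 3) → EuclideanSpace ℝ (Fin 3)}

/-! ### Equalising the constants -/

/-- The KNSS-gauge Type-I class is monotone in its constant. [folklore] -/
theorem isTypeIAncientMild_of_le {C C' : ℝ} (h : IsTypeIAncientMild C V) (hle : C ≤ C') :
    IsTypeIAncientMild C' V := by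
  refine ⟨h.1, h.2.1, h.2.2.1, fun t ht x => (h.2.2.2 t ht x).trans ?_⟩
  exact div_le_div_of_nonneg_right hle (Real.sqrt_nonneg _)

/-- The Type-I envelope is monotone in its constant. [folklore] -/
theorem hasTypeIDecay_of_le {A A' : ℝ} (h : HasTypeIDecay A V) (hle : A ≤ A') :
    HasTypeIDecay A' V := fun t ht x =>
  (h t ht x).trans (div_le_div_of_nonneg_right hle (by positivity))

/-! ### The budget at the threshold -/

section Budget

/-- **The similarity-enstrophy budget as a slack.** For a KNSS-gauge Type-I field `V` with a Type-I
envelope (same constant), the global similarity enstrophy `Z(s) = ∫‖Ω(s)‖²` satisfies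
`Z'(s) = −2∫(‖curl Ω‖² + ¼‖Ω‖² − ⟪U, Ω × curl Ω⟫)` (`½Z' = −D − ¼Z + Str`, `Str = ∫⟪U, Ω×curl Ω⟫`,
`D = ∫‖curl Ω‖²`). [folklore energy method] -/
theorem hasDerivAt_enstrophy_eq_neg_two_integral_slack (hV : IsTypeIAncientMild C V)
    (hdec : HasTypeIDecay C V) (s : ℝ) :
    HasDerivAt (fun σ => ∫ y, ‖lerayVorticity V σ y‖ ^ 2)
      (-2 * ∫ y, (‖curl (lerayVorticity V s) y‖ ^ 2 + (1 / 4) * ‖lerayVorticity V s y‖ ^ 2 -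
        ⟪lerayOrbit V s y, cross (lerayVorticity V s y) (curl (lerayVorticity V s) y)⟫)) s := by
  obtain ⟨C₁, C₂, C₃, hD1, hD2, hD3⟩ := IsTypeIAncientMild.gaugeBounds_of_hasTypeIDecay hV hdec
  have h := similarityEnstrophy_hasDerivAt hV hD1 hD2 hD3 s
  refine h.congr_deriv ?_
  have iC := integrable_norm_curl_lerayVorticity_sq hV hD2 s
  have iZ := integrable_norm_lerayVorticity_sq hV hD1 s
  have iΛ := integrable_inner_lerayOrbit_lamb hV hD1 hD2 s
  have iZ' : Integrable fun y => (1 / 4 : ℝ) * ‖lerayVorticity V s y‖ ^ 2 := iZ.const_mul _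
  have iAB : Integrable fun y => ‖curl (lerayVorticity V s) y‖ ^ 2 +
      (1 / 4 : ℝ) * ‖lerayVorticity V s y‖ ^ 2 := iC.add iZ'
  have e : (∫ y, (‖curl (lerayVorticity V s) y‖ ^ 2 + (1 / 4) * ‖lerayVorticity V s y‖ ^ 2 -
      ⟪lerayOrbit V s y, cross (lerayVorticity V s y) (curl (lerayVorticity V s) y)⟫)) =
      (∫ y, ‖curl (lerayVorticity V s) y‖ ^ 2) + (1 / 4) * (∫ y, ‖lerayVorticity V s y‖ ^ 2) -
        ∫ y, ⟪lerayOrbit V s y, cross (lerayVorticity V s y) (curl (lerayVorticity V s) y)⟫ := by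
    rw [integral_sub iAB iΛ, integral_add iC iZ', integral_const_mul]
  rw [integral_stretching_eq_integral_inner_lamb hV hD1 hD2 s,
    ← integral_norm_curl_lerayVorticity_sq_eq hV hD1 hD2 s, e]
  ring

/-- **Under cross-flow `≤ 1` the global similarity enstrophy is non-increasing.** If
`‖Ω(s,y) × U(s,y)‖ ≤ ‖Ω(s,y)‖` for all `s, y`, then `s ↦ ∫‖Ω(s)‖²` is antitone (the slack density is
nonnegative). [folklore energy method] -/
theorem antitone_enstrophy_of_crossFlow_le_one (hV : IsTypeIAncientMild C V) (hdec : HasTypeIDecay C V)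
    (hX : ∀ (s : ℝ) (y : EuclideanSpace ℝ (Fin 3)),
      ‖cross (lerayVorticity V s y) (lerayOrbit V s y)‖ ≤ ‖lerayVorticity V s y‖) :
    Antitone fun σ => ∫ y, ‖lerayVorticity V σ y‖ ^ 2 := by
  have hd := fun s => hasDerivAt_enstrophy_eq_neg_two_integral_slack hV hdec s
  refine antitone_of_deriv_nonpos (fun s => (hd s).differentiableAt) fun s => ?_
  rw [(hd s).deriv]
  have hσ : 0 ≤ ∫ y, (‖curl (lerayVorticity V s) y‖ ^ 2 + (1 / 4) * ‖lerayVorticity V s y‖ ^ 2 -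
      ⟪lerayOrbit V s y, cross (lerayVorticity V s y) (curl (lerayVorticity V s) y)⟫) :=
    integral_nonneg fun y => crossFlowSlack_nonneg (hX s y) _
  linarith

/-- **Cross-flow `≤ 1` and a periodic enstrophy force `V ≡ 0`.** If moreover `Z(s + T) = Z(s)` for
all `s` (some `T > 0`), then `Z` is constant (antitone and periodic), so `∫σ(s) = 0` for every `s`;
the slack density being continuous, nonnegative and integrable, it vanishes identically, every slice
is in the equality case and hence irrotational (`lerayVorticity_slice_eq_zero_of_crossFlowSlack_eq_zero`),
and irrotational bounded divergence-free slices are constant, killed by the gauge. [folklore] -/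
theorem eq_zero_of_crossFlow_le_one_of_enstrophy_periodic (hV : IsTypeIAncientMild C V)
    (hdec : HasTypeIDecay C V)
    (hX : ∀ (s : ℝ) (y : EuclideanSpace ℝ (Fin 3)),
      ‖cross (lerayVorticity V s y) (lerayOrbit V s y)‖ ≤ ‖lerayVorticity V s y‖)
    {T : ℝ} (hT : 0 < T) (hper : ∀ s : ℝ, (∫ y, ‖lerayVorticity V (s + T) y‖ ^ 2) =
      ∫ y, ‖lerayVorticity V s y‖ ^ 2) :
    ∀ t < 0, ∀ x, V t x = 0 := by
  obtain ⟨C₁, C₂, C₃, hD1, hD2, -⟩ := IsTypeIAncientMild.gaugeBounds_of_hasTypeIDecay hV hdec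
  set Z : ℝ → ℝ := fun σ => ∫ y, ‖lerayVorticity V σ y‖ ^ 2 with hZdef
  have hanti : Antitone Z := antitone_enstrophy_of_crossFlow_le_one hV hdec hX
  -- periodicity along the multiples of `T`
  have hperN : ∀ (s : ℝ) (n : ℕ), Z (s + n * T) = Z s := by
    intro s n
    induction n with
    | zero => simp
    | succ n ih =>
        have e : s + (↑(n + 1) : ℝ) * T = (s + n * T) + T := by push_cast; ring
        rw [e, show Z (s + ↑n * T + T) = Z (s + ↑n * T) from hper _, ih]
  -- `Z` is constant
  have hconst : ∀ s s' : ℝ, Z s' = Z s := by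
    intro s s'
    rcases le_total s s' with h | h
    · refine le_antisymm (hanti h) ?_
      obtain ⟨n, hn⟩ := exists_nat_ge ((s' - s) / T)
      have hle : s' ≤ s + n * T := by
        have := (div_le_iff₀ hT).1 hn
        linarith
      rw [← hperN s n]
      exact hanti hle
    · refine le_antisymm ?_ (hanti h)
      obtain ⟨n, hn⟩ := exists_nat_ge ((s - s') / T)
      have hle : s ≤ s' + n * T := by
        have := (div_le_iff₀ hT).1 hn
        linarith
      rw [← hperN s' n]
      exact hanti hle
  -- hence the slack integral vanishes at every time
  have hslack : ∀ s, ∫ y, (‖curl (lerayVorticity V s) y‖ ^ 2 + (1 / 4) * ‖lerayVorticity V s y‖ ^ 2 -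
      ⟪lerayOrbit V s y, cross (lerayVorticity V s y) (curl (lerayVorticity V s) y)⟫) = 0 := by
    intro s
    have hd := hasDerivAt_enstrophy_eq_neg_two_integral_slack hV hdec s
    have hc : HasDerivAt Z 0 s := by
      have : Z = fun _ => Z 0 := funext fun σ => hconst 0 σ
      rw [this]; exact hasDerivAt_const _ _
    have := hd.unique hc
    linarith
  -- so the slack density vanishes identically on every slice
  have hΩ0 : ∀ s y, lerayVorticity V s y = 0 := by
    intro s
    have iC := integrable_norm_curl_lerayVorticity_sq hV hD2 s
    have iZ := integrable_norm_lerayVorticity_sq hV hD1 s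
    have iΛ := integrable_inner_lerayOrbit_lamb hV hD1 hD2 s
    have hint : Integrable fun y => ‖curl (lerayVorticity V s) y‖ ^ 2 +
        (1 / 4) * ‖lerayVorticity V s y‖ ^ 2 -
        ⟪lerayOrbit V s y, cross (lerayVorticity V s y) (curl (lerayVorticity V s) y)⟫ :=
      (iC.add (iZ.const_mul _)).sub iΛ
    have hΩinf := contDiff_lerayVorticity_slice hV s
    have hΩc : ContDiff ℝ 1 (lerayVorticity V s) := hΩinf.of_le (by norm_cast)
    have hC1 : ContDiff ℝ 1 (curl (lerayVorticity V s)) :=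
      contDiff_curl (n := 1) (hΩinf.of_le (by norm_cast))
    have hCc : Continuous (curl (lerayVorticity V s)) := hC1.continuous
    have hUc : Continuous (lerayOrbit V s) :=
      (contDiff_lerayOrbit_slice_of_typeI hV s (n := 1) (by norm_cast)).continuous
    have hXc : Continuous fun y => cross (lerayVorticity V s y) (curl (lerayVorticity V s) y) :=
      ((crossCLM.contDiff.comp hΩc).clm_apply hC1).continuous
    have hcont : Continuous fun y => ‖curl (lerayVorticity V s) y‖ ^ 2 +
        (1 / 4) * ‖lerayVorticity V s y‖ ^ 2 -
        ⟪lerayOrbit V s y, cross (lerayVorticity V s y) (curl (lerayVorticity V s) y)⟫ :=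
      ((hCc.norm.pow 2).add (continuous_const.mul (hΩc.continuous.norm.pow 2))).sub (hUc.inner hXc)
    have hae := (integral_eq_zero_iff_of_nonneg (fun y => crossFlowSlack_nonneg (hX s y) _) hint).1
      (hslack s)
    have hev := (hcont.ae_eq_iff_eq (μ := volume) continuous_const).1 hae
    exact lerayVorticity_slice_eq_zero_of_crossFlowSlack_eq_zero hV hdec s (hX s)
      (fun y => congrFun hev y)
  -- `V ≡ 0`
  have hcurl : ∀ t < 0, ∀ x, curl (V t) x = 0 := by
    intro t ht x
    set s : ℝ := -Real.log (-t) with hs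
    have hts : -Real.exp (-s) = t := by
      rw [hs, neg_neg, Real.exp_log (neg_pos.2 ht), neg_neg]
    have h := hΩ0 s ((Real.exp (-s / 2))⁻¹ • x)
    rw [lerayVorticity_apply, curl_lerayOrbit, smul_smul,
      mul_inv_cancel₀ (Real.exp_pos _).ne', one_smul, hts, smul_eq_zero] at h
    exact h.resolve_left (Real.exp_pos _).ne'
  have hconstV : ∀ t < 0, ∀ x, V t x = V t 0 := fun t ht x =>
    eq_of_curl_eq_zero_of_isDivFree_of_bounded ((hV.contDiff_slice ht).of_le (by norm_cast))
      (hcurl t ht) (hV.isDivFree ht) (fun z => hV.norm_le ht z) x 0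
  exact fun t ht x => hV.eq_zero_of_slice_const (b := fun t => V t 0) hconstV ht x

end Budget

/-! ### The DSS wall at the cross-flow threshold -/

section Dss

/-- **Past-DSS makes the Leray orbit periodic**: if `c • V(c²t, c x) = V(t, x)` for all `t < 0`
(`c > 0`), then `U(s − 2 log c) = U(s)`. [cite: ChaeWolf2017RemovingDSS, §4 (DSS ⇔ periodic orbit)] -/
theorem lerayOrbit_sub_period_of_pastDss {c : ℝ} (hc : 0 < c)
    (hdss : ∀ t : ℝ, t < 0 → ∀ x, c • V (c ^ 2 * t) (c • x) = V t x) (s : ℝ)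
    (y : EuclideanSpace ℝ (Fin 3)) :
    lerayOrbit V (s - 2 * Real.log c) y = lerayOrbit V s y := by
  have hc' : c ≠ 0 := hc.ne'
  have h1 : Real.exp (-(s - 2 * Real.log c) / 2) = Real.exp (-s / 2) * c := by
    rw [show -(s - 2 * Real.log c) / 2 = -s / 2 + Real.log c by ring, Real.exp_add, Real.exp_log hc]
  have h2 : Real.exp (-(s - 2 * Real.log c)) = Real.exp (-s) * c ^ 2 := by
    rw [show -(s - 2 * Real.log c) = -s + 2 * Real.log c by ring, Real.exp_add,
      show (2 : ℝ) * Real.log c = Real.log c + Real.log c by ring, Real.exp_add, Real.exp_log hc, sq]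
  have ht : -Real.exp (-s) < 0 := neg_neg_of_pos (Real.exp_pos _)
  have key := hdss (-Real.exp (-s)) ht (Real.exp (-s / 2) • y)
  have eA : -(Real.exp (-s) * c ^ 2) = c ^ 2 * -Real.exp (-s) := by ring
  have eB : (Real.exp (-s / 2) * c) • y = c • (Real.exp (-s / 2) • y) := by
    rw [smul_smul, mul_comm]
  rw [lerayOrbit_apply, lerayOrbit_apply, h1, h2, eA, eB, ← key]
  simp only [smul_smul]

/-- **THE CROSS-FLOW THRESHOLD ONE ON THE DSS WALL, every factor.** A KNSS-gauge Type-I field `V`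
with a Type-I envelope (same constant `C`), discretely self-similar on the past with some factor
`c > 1`, whose velocity component across the vorticity never exceeds the self-similar speed —
`√(−t)‖curl V(t,x) × V(t,x)‖ ≤ ‖curl V(t,x)‖` for all `t < 0`, `x` — vanishes identically on `t < 0`.
(Similarity variables: `‖Ω × U‖ ≤ ‖Ω‖`; the orbit is `2 log c`-periodic, so is `Z`;
`eq_zero_of_crossFlow_le_one_of_enstrophy_periodic`.) The tree's law-free rung needs the strict
threshold `θ < 1`. [folklore energy method] -/
theorem eq_zero_of_pastDss_of_crossFlow_le_one (hV : IsTypeIAncientMild C V) (hdec : HasTypeIDecay C V)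
    {c : ℝ} (hc : 1 < c) (hdss : ∀ t : ℝ, t < 0 → ∀ x, c • V (c ^ 2 * t) (c • x) = V t x)
    (hX : ∀ t < 0, ∀ x, Real.sqrt (-t) * ‖cross (curl (V t) x) (V t x)‖ ≤ ‖curl (V t) x‖) :
    ∀ t < 0, ∀ x, V t x = 0 := by
  -- the hypothesis in similarity variables
  have hXs : ∀ (s : ℝ) (y : EuclideanSpace ℝ (Fin 3)),
      ‖cross (lerayVorticity V s y) (lerayOrbit V s y)‖ ≤ ‖lerayVorticity V s y‖ := by
    intro s y
    have hl0 : 0 < Real.exp (-s / 2) := Real.exp_pos _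
    have hk0 : 0 < Real.exp (-s) := Real.exp_pos _
    have ht0 : -Real.exp (-s) < 0 := neg_neg_of_pos hk0
    have hU : lerayOrbit V s y =
        Real.exp (-s / 2) • V (-Real.exp (-s)) (Real.exp (-s / 2) • y) := by
      rw [lerayOrbit_apply]
    have hΩ : lerayVorticity V s y =
        Real.exp (-s) • curl (V (-Real.exp (-s))) (Real.exp (-s / 2) • y) := by
      rw [lerayVorticity_apply, curl_lerayOrbit]
    have h := hX _ ht0 (Real.exp (-s / 2) • y)
    rw [neg_neg, sqrt_exp_neg] at h
    set N : ℝ := ‖cross (curl (V (-Real.exp (-s))) (Real.exp (-s / 2) • y))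
        (V (-Real.exp (-s)) (Real.exp (-s / 2) • y))‖ with hN
    set B : ℝ := ‖curl (V (-Real.exp (-s))) (Real.exp (-s / 2) • y)‖ with hB
    have eL : ‖cross (lerayVorticity V s y) (lerayOrbit V s y)‖ =
        Real.exp (-s) * (Real.exp (-s / 2) * N) := by
      rw [hU, hΩ, cross_smul_left, cross_smul_right, norm_smul, norm_smul,
        Real.norm_of_nonneg hk0.le, Real.norm_of_nonneg hl0.le]
    have eR : ‖lerayVorticity V s y‖ = Real.exp (-s) * B := by
      rw [hΩ, norm_smul, Real.norm_of_nonneg hk0.le]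
    rw [eL, eR]
    exact mul_le_mul_of_nonneg_left h hk0.le
  -- the orbit is periodic with period `T = 2 log c`
  have hc0 : 0 < c := lt_trans one_pos hc
  have hT : 0 < 2 * Real.log c := by positivity [Real.log_pos hc]
  refine eq_zero_of_crossFlow_le_one_of_enstrophy_periodic hV hdec hXs hT fun s => ?_
  have hfun : lerayVorticity V (s + 2 * Real.log c) = lerayVorticity V s := by
    have h1 : lerayOrbit V s = lerayOrbit V (s + 2 * Real.log c) := by
      funext y
      have := lerayOrbit_sub_period_of_pastDss hc0 hdss (s + 2 * Real.log c) y
      rwa [add_sub_cancel_right] at this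
    rw [lerayVorticity_apply, lerayVorticity_apply, ← h1]
  rw [hfun]

/-- The same for a field discretely self-similar at all times (`IsDiscretelySelfSimilar c V`).
[folklore energy method] -/
theorem eq_zero_of_pastDss_of_crossFlow_le_one' (hV : IsTypeIAncientMild C V)
    (hdec : HasTypeIDecay C V) {c : ℝ} (hc : 1 < c) (hdss : IsDiscretelySelfSimilar c V)
    (hX : ∀ t < 0, ∀ x, Real.sqrt (-t) * ‖cross (curl (V t) x) (V t x)‖ ≤ ‖curl (V t) x‖) :
    ∀ t < 0, ∀ x, V t x = 0 := by
  refine eq_zero_of_pastDss_of_crossFlow_le_one hV hdec hc (fun t _ x => ?_) hX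
  have h := congrFun (congrFun hdss t) x
  rwa [nsRescale_apply] at h

end Dss

end Summit.NavierStokesRegularity.NavierStokesRegularity.Theorems.FiniteDissipationLiouville.CrossFlow

end
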